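import Summits.CriticalPhenomena.PercolationContinuityZ3.Theorems.PercNearOneGluingNoHeavyLowerTailCSHLevelForms
import Literature.Probability.LatticeModels.ProdBernoulliIndependence
import Literature.Probability.LatticeModels.ProdBernoulliWeightContinuity
import Literature.Probability.Percolation.KozmaNitzanPreFKG
import HarnessLib

/-!
# The conditioned slack hierarchy with EMPTY avoided set is attained: the all-open star `f_S` has margin `0`
# at every level, and pins every principal constant (PAPER-2 track (ii), §7 `s:gluing-constants`, Prop. `prop:csh-sharp`)
NOTE (landing, prim-consts-2): the staged file prim-paper-s3/lean/CSHSharpWitness.lean (659 lines, md5 befaa0ceb389) is landed VERBATIM but SPLIT in two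
for the tree's 400-line rule: this file = events/tools (staged lines 1–336); identity (a), (b), (c), strict signs, packaging =
`PercNearOneGluingNoHeavyLowerTailCSHSharpWitnessMargins.lean` (staged lines 337–659). Declaration names and proofs unchanged, except that the
staged helper `openConn_comm` is dropped (it restated the tree's `KNPreFKG.openConn_symm`, gate `dedup.landed`) and its uses call `KNPreFKG.openConn_symm`.


builds on p205010 (kernel theorem, internal audit signed; external expert review pending)

Helper file for the cruxes `NoHeavyLowerTail` (stmt-CriticalPhenomena-4575) / `AdditiveGluing` (stmt-4576): a SHARPNESS
statement about the constants of the conditioned slack hierarchy `CSH.CSHHolds` (memo Theorem 1 = `CSH.cshHolds`,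
file `…NoHeavyLowerTailCSHTheoremOne`; companion paper §3, Thm. 3.5).  No named facts, no sorries; standard axioms.
Written by the paper cell (prim-paper-s3, gen 66) from its hand-over memo to track (ii)
(`run/shared/lean/prim/consts/FROM-prim-paper-s3-g65-CSH-SHARPNESS-ADDENDUM.md`, finding F5), whose numbers were re-derived
independently by CONSTS-REF (`consts/csh_ref2.py`).

THE STATEMENT.  Datum: owner `x`, avoided set `Y = ∅`, decoys `D = (d_1, …, d_k)`, observers `o, v`; `S := {x} ∪ D`
(a finset with `v ∉ S`), `W := ∏_{s ∈ S} w(s v)`, and the increasing functional of the owner's open edge cluster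
  `f_S(E) := 1{ s(s, v) ∈ E for every s ∈ S }`   (`CSH.SharpWitness.allOpenTo S v`; "every pair joining `v` to `S` is open").
Write `{u ~ A}` for the event that the open cluster of `u` meets the vertex set `A` (`CSH.SharpWitness.hits u A`),
`Y_A := {x} ∪ A` for the avoided set after the decoys `A`, `c_j = CSH.avoidConst`, `p = CSH.obsConst` (file `…CSHDefs`).

* `slForm_decoyList_covD_allOpenTo` — IDENTITY (a): for every list `D₁` of elements of `S` and every vertex `u`,
    `sl_{D₁}[covD(f_S)](u) = W · ( μ{u ~ S ∪ {v}} − μ{u ~ {x} ∪ D₁} )`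
  (all pair weights in `[0,1]`, any finite graph: no non-degeneracy and no distinctness is needed; Lean's `x/0 = 0` makes the
  degenerate cases automatic);
* `slForm_decoyList_covD_allOpenTo_decoy` — the level coefficient `B = sl_{D₁}[covD(f_S)](d) = W · μ{d ↮ {x} ∪ D₁}` for `d ∈ S`;
* `cshMargin_allOpenTo_eq_zero` — (b): `cshMargin w x ∅ D o v f_S = 0`, i.e. CSH(∅; x; D; o, v)[f_S] holds with EQUALITY, for every
  `D` with `S = {x} ∪ D ∌ v` (so memo Theorem 1 cannot be improved by a positive additive term at `Y = ∅`);
* (c) one parameter at a time, the others kept — exact affine formulas for the perturbed margins of `f_S`: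
  `cshMarg_allOpenTo_obsConst'` (observer constant `p ↦ p'`: margin `= (p − p')·W·μ{v ↮ S}`),
  `cshMarg_allOpenTo_perturb_o` (the `j`-th decoy constant changed at `o` only: margin `= −(c'(o) − c_j(o))·B_j`),
  `cshMarg_allOpenTo_perturb_v` (changed at `v` only: margin `= p·(c'(v) − c_j(v))·B_j`);
  and, for non-degenerate weights (`0 < w < 1` on all pairs) and `o ∉ S ∪ {v}`, the strict signs
  `cshMarg_allOpenTo_neg_of_obsConst_lt`, `cshMarg_allOpenTo_neg_of_lt_at_o`, `cshMarg_allOpenTo_neg_of_lt_at_v`: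
  raising `p`, raising a single `c_j(o)`, or lowering a single `c_j(v)` by any amount makes the margin of `f_S` NEGATIVE
  (packaged as `exists_cshMarg_neg_of_obsConst_lt / _of_lt_at_o / _of_lt_at_v`: the strengthened hierarchy fails).
  Hence, with `Y = ∅`, each of the `2k+1` principal constants of the level-`k` hierarchy is best possible in its strengthening
  direction on every finite weighted graph, witnessed by the single functional `f_S`.

(For `Y ≠ ∅` nothing of the kind holds: exact small cases in the memo, F6 — e.g. `K₄`, `Y = {y}`: `p = 1/5` while every
`p' ≤ 9/25` is admissible.)  Proof = the five-line computation of the memo: on `{f_S = 1}` the set `S ∪ {v}` is one open cluster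
containing `x`, so `{x ↔ u} = {u ~ S ∪ {v}}`, an event determined by the pairs NOT inside `S ∪ {v}`, hence independent of
`{f_S = 1}` (`prodBernoulli_real_inter_of_determinedBy`); then induction along the decoys using
`μ{u ~ Y ∪ {d}} = μ{u ~ Y} + μ{d ↔ u, d ↮ Y}`.
[cite: VandenbergHaggstromKahn2005, Thm. 1.3 (p. 6)] [cite: KozmaNitzan2024, Conj. 4 (p. 32)]
-/

noncomputable section

namespace Summit.CriticalPhenomena.PercolationContinuityZ3.Theorems

open MeasureTheory Set Literature.Probability.LatticeModels Literature.Probability.Percolation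
open scoped Classical

namespace CSH

namespace SharpWitness

variable {V : Type*}

/-! ### Events: the cluster of `u` meets / avoids a vertex set -/

/-- The event `{u ~ A}`: the open cluster of `u` meets the vertex set `A`. [folklore] -/
def hits (u : V) (A : Set V) : Set (BondConfig V) := {ω | ∃ a ∈ A, (openGraph ω).Reachable u a}

/-- Unfolding of `hits`. [folklore] -/
theorem mem_hits {u : V} {A : Set V} {ω : BondConfig V} : ω ∈ hits u A ↔ ∃ a ∈ A, (openGraph ω).Reachable u a :=
  Iff.rfl

/-- The complement of `{u ~ A}` is the avoidance event `{u ↮ A}` of the CSH definitions. [folklore] -/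
theorem compl_hits (u : V) (A : Set V) :
    (hits u A)ᶜ = {ω : BondConfig V | ∀ a ∈ A, ¬ (openGraph ω).Reachable u a} := by
  ext ω; simp [hits]

/-- `{u ~ A}` is the whole space when `u ∈ A`. [folklore] -/
theorem hits_eq_univ_of_mem {u : V} {A : Set V} (hu : u ∈ A) : hits u A = univ :=
  eq_univ_of_forall fun _ => ⟨u, hu, SimpleGraph.Reachable.refl u⟩

/-- `{u ~ {x}} = {x ↔ u}`. [folklore] -/
theorem hits_singleton (u x : V) : hits u {x} = openConn x u := by
  ext ω
  simp only [hits, mem_singleton_iff, exists_eq_left, mem_setOf_eq, openConn]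
  exact ⟨fun h => h.symm, fun h => h.symm⟩

/-- `{u ~ A}` is monotone in `A`. [folklore] -/
theorem hits_mono (u : V) {A B : Set V} (h : A ⊆ B) : hits u A ⊆ hits u B :=
  fun _ ⟨a, ha, hr⟩ => ⟨a, h ha, hr⟩

/-- **One more target.** `{u ~ A ∪ {d}} = {u ~ A} ⊔ ({d ↮ A} ∩ {d ↔ u})`: adding the vertex `d` to the target set adds exactly
the configurations in which `u` is joined to `d` and `d` (equivalently `u`) avoids `A`. [folklore] -/
theorem hits_insert_eq (u d : V) (A : Set V) :
    hits u (insert d A) = hits u A ∪ ({ω : BondConfig V | ∀ a ∈ A, ¬ (openGraph ω).Reachable d a} ∩ openConn d u) := by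
  ext ω
  simp only [hits, mem_insert_iff, mem_union, mem_setOf_eq, mem_inter_iff, openConn]
  constructor
  · rintro ⟨a, (rfl | ha), hr⟩
    · by_cases hA : ∃ a' ∈ A, (openGraph ω).Reachable u a'
      · exact Or.inl hA
      · push Not at hA
        exact Or.inr ⟨fun a' ha' hda' => hA a' ha' (hr.trans hda'), hr.symm⟩
    · exact Or.inl ⟨a, ha, hr⟩
  · rintro (⟨a, ha, hr⟩ | ⟨-, hr⟩)
    · exact ⟨a, Or.inr ha, hr⟩
    · exact ⟨d, Or.inl rfl, hr.symm⟩

/-- The two pieces of `hits_insert_eq` are disjoint. [folklore] -/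
theorem disjoint_hits_avoid (u d : V) (A : Set V) :
    Disjoint (hits u A) ({ω : BondConfig V | ∀ a ∈ A, ¬ (openGraph ω).Reachable d a} ∩ openConn d u) := by
  refine disjoint_left.2 fun ω ⟨a, ha, hr⟩ ⟨hav, hdu⟩ => ?_
  exact hav a ha ((show (openGraph ω).Reachable d u from hdu).trans hr)

/-- **Measure form of `hits_insert_eq`**: `μ{u ~ A ∪ {d}} = μ{u ~ A} + μ{d ↮ A, d ↔ u}`. [folklore] -/
theorem real_hits_insert [Fintype V] (μ : Measure (BondConfig V)) [IsFiniteMeasure μ] (u d : V) (A : Set V) :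
    μ.real (hits u (insert d A)) =
      μ.real (hits u A) + μ.real ({ω : BondConfig V | ∀ a ∈ A, ¬ (openGraph ω).Reachable d a} ∩ openConn d u) := by
  rw [hits_insert_eq, measureReal_union (disjoint_hits_avoid u d A) MeasurableSet.of_discrete]

/-- `μ{u ↮ A} = 1 − μ{u ~ A}` for a probability measure. [folklore] -/
theorem real_avoid_eq_one_sub [Fintype V] (μ : Measure (BondConfig V)) [IsProbabilityMeasure μ] (u : V) (A : Set V) :
    μ.real {ω : BondConfig V | ∀ a ∈ A, ¬ (openGraph ω).Reachable u a} = 1 - μ.real (hits u A) := by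
  rw [← compl_hits, measureReal_compl MeasurableSet.of_discrete, probReal_univ]

/-! ### `{u ~ T}` is determined by the pairs not inside `T` -/

/-- If two configurations agree on every pair with an endpoint outside `T`, an open path of the first from `u` to `T`
yields one of the second (stop at the first vertex of `T`). [folklore] -/
theorem hits_of_agree_off {T : Set V} {ω ω' : BondConfig V}
    (h : ∀ e : Sym2 V, (∃ z ∈ e, z ∉ T) → (e ∈ ω ↔ e ∈ ω')) {u : V} (hu : ω ∈ hits u T) : ω' ∈ hits u T := by
  obtain ⟨t, ht, ⟨p⟩⟩ := hu
  induction p with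
  | nil => exact ⟨_, ht, SimpleGraph.Reachable.refl _⟩
  | cons hadj p ih =>
    rename_i a b c
    by_cases ha : a ∈ T
    · exact ⟨a, ha, SimpleGraph.Reachable.refl _⟩
    · obtain ⟨t', ht', hbt'⟩ := ih ht
      have hadj' : (openGraph ω').Adj a b := by
        rw [openGraph_adj] at hadj ⊢
        exact ⟨(h _ ⟨a, Sym2.mem_mk_left a b, ha⟩).1 hadj.1, hadj.2⟩
      exact ⟨t', ht', hadj'.reachable.trans hbt'⟩

/-- `{u ~ T}` is determined by the set of pairs having an endpoint outside `T`. [folklore] -/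
theorem determinedBy_hits (u : V) (T : Set V) : DeterminedBy (hits u T) {e : Sym2 V | ∃ z ∈ e, z ∉ T} := by
  rw [determinedBy_iff]
  intro ω ω' hωω'
  have h1 : ∀ e : Sym2 V, (∃ z ∈ e, z ∉ T) → (e ∈ ω ↔ e ∈ ω') := fun e he => by
    have := Set.ext_iff.1 hωω' e
    simp only [mem_inter_iff, mem_setOf_eq] at this
    exact ⟨fun hω => (this.1 ⟨hω, he⟩).1, fun hω' => (this.2 ⟨hω', he⟩).1⟩
  have h2 : ∀ e : Sym2 V, (∃ z ∈ e, z ∉ T) → (e ∈ ω' ↔ e ∈ ω) := fun e he => (h1 e he).symm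
  exact ⟨hits_of_agree_off h1, hits_of_agree_off h2⟩

/-! ### The witness functional `f_S` and its event -/

/-- **The witness `f_S`**: the indicator that every pair `s(s, v)`, `s ∈ S`, belongs to the edge set `E` (applied to the open
edge cluster of the owner: "all pairs joining `v` to `S` are open"). (paper-2 track (ii), Prop. `prop:csh-sharp`; memo F5) -/
def allOpenTo (S : Finset V) (v : V) (E : Set (Sym2 V)) : ℝ := if ∀ s ∈ S, s(s, v) ∈ E then 1 else 0

/-- The event `{every pair s(s, v), s ∈ S, is open}`. [folklore] -/
def starOpen (S : Finset V) (v : V) : Set (BondConfig V) := {ω | ∀ s ∈ S, s(s, v) ∈ ω}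

/-- **The weight `W = ∏_{s ∈ S} w(s v)`** of the witness. [folklore] -/
def starWeight (w : Sym2 V → unitInterval) (S : Finset V) (v : V) : ℝ := ∏ s ∈ S, (w s(s, v) : ℝ)

/-- `f_S` is increasing. [folklore] -/
theorem allOpenTo_monotone (S : Finset V) (v : V) : Monotone (allOpenTo S v) := by
  intro E E' hEE'
  unfold allOpenTo
  by_cases h : ∀ s ∈ S, s(s, v) ∈ E
  · rw [if_pos h, if_pos fun s hs => hEE' (h s hs)]
  · rw [if_neg h]; split_ifs <;> norm_num

/-- `f_S` takes values in `{0, 1}`; in particular it is an indicator: `f_S(C_x(ω)) = 1_{starOpen}(ω)` as soon as `x ∈ S` and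
`v ∉ S` (then on `starOpen` the star is part of the open edge cluster of `x`). [folklore] -/
theorem allOpenTo_openEdgeCluster {S : Finset V} {x v : V} (hx : x ∈ S) (hv : v ∉ S) (ω : BondConfig V) :
    allOpenTo S v (openEdgeCluster ω x) = (starOpen S v).indicator 1 ω := by
  have hxv : x ≠ v := fun h => hv (h ▸ hx)
  by_cases hω : ω ∈ starOpen S v
  · rw [indicator_of_mem hω, Pi.one_apply, allOpenTo, if_pos]
    intro s hs
    have hsv : s ≠ v := fun h => hv (h ▸ hs)
    have hxadj : (openGraph ω).Adj x v := (openGraph_adj ω x v).2 ⟨hω x hx, hxv⟩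
    have hsadj : (openGraph ω).Adj s v := (openGraph_adj ω s v).2 ⟨hω s hs, hsv⟩
    refine (mem_openEdgeCluster_iff ω x _).2 ⟨hω s hs, ?_, ?_⟩
    · rw [Sym2.mk_isDiag_iff]; exact hsv
    · intro z hz
      rcases Sym2.mem_iff.1 hz with rfl | rfl
      · exact hxadj.reachable.trans hsadj.reachable.symm
      · exact hxadj.reachable
  · rw [indicator_of_notMem hω, allOpenTo, if_neg]
    intro h
    exact hω fun s hs => openEdgeCluster_subset ω x (h s hs)

/-- `starOpen S v` is the cylinder `{F ⊆ ω}` of the finset `F = {s(s, v) : s ∈ S}`. [folklore] -/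
theorem starOpen_eq_setOf_subset (S : Finset V) (v : V) :
    starOpen S v = {ω : BondConfig V | (↑(S.image fun s => s(s, v)) : Set (Sym2 V)) ⊆ ω} := by
  ext ω
  simp only [starOpen, mem_setOf_eq, Finset.coe_image, image_subset_iff]
  rfl

/-- `s ↦ s(s, v)` is injective. [folklore] -/
theorem mk_right_injective (v : V) : Function.Injective fun s : V => s(s, v) := by
  intro s s' h
  have h' := Sym2.eq_iff.1 h
  rcases h' with ⟨h1, -⟩ | ⟨h1, h2⟩
  · exact h1
  · exact h1.trans h2

/-- **`μ(starOpen) = W`** (product structure of `prodBernoulli`). [folklore] -/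
theorem real_starOpen (w : Sym2 V → unitInterval) (S : Finset V) (v : V) :
    (prodBernoulli w).real (starOpen S v) = starWeight w S v := by
  rw [starOpen_eq_setOf_subset, prodBernoulli_real_subset, starWeight,
    Finset.prod_image fun s _ s' _ h => mk_right_injective v h]

/-- `starOpen S v` is determined by the pairs of the star. [folklore] -/
theorem determinedBy_starOpen (S : Finset V) (v : V) :
    DeterminedBy (starOpen S v) (↑(S.image fun s => s(s, v)) : Set (Sym2 V)) := by
  rw [determinedBy_iff]
  intro ω ω' h
  simp only [starOpen, mem_setOf_eq]
  have key : ∀ s ∈ S, (s(s, v) ∈ ω ↔ s(s, v) ∈ ω') := fun s hs => by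
    have hmem : s(s, v) ∈ (↑(S.image fun s => s(s, v)) : Set (Sym2 V)) := by
      rw [Finset.coe_image]; exact mem_image_of_mem _ hs
    have := Set.ext_iff.1 h s(s, v)
    simp only [mem_inter_iff] at this
    exact ⟨fun hω => (this.1 ⟨hω, hmem⟩).1, fun hω' => (this.2 ⟨hω', hmem⟩).1⟩
  exact ⟨fun H s hs => (key s hs).1 (H s hs), fun H s hs => (key s hs).2 (H s hs)⟩

/-- **Independence**: `μ(starOpen ∩ {u ~ S ∪ {v}}) = W · μ{u ~ S ∪ {v}}` — the star lies inside `S ∪ {v}`, the hitting event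
is determined by the pairs with an endpoint outside. [folklore] -/
theorem real_starOpen_inter_hits [Fintype V] (w : Sym2 V → unitInterval) (S : Finset V) (v u : V) :
    (prodBernoulli w).real (starOpen S v ∩ hits u (insert v (↑S : Set V))) =
      starWeight w S v * (prodBernoulli w).real (hits u (insert v (↑S : Set V))) := by
  rw [← real_starOpen]
  refine prodBernoulli_real_inter_of_determinedBy w (S.image fun s => s(s, v)) (determinedBy_starOpen S v)
    ((determinedBy_hits u _).mono ?_) MeasurableSet.of_discrete MeasurableSet.of_discrete
  rintro e ⟨z, hz, hzT⟩ he
  rw [Finset.coe_image] at he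
  obtain ⟨s, hs, rfl⟩ := he
  rcases Sym2.mem_iff.1 hz with rfl | rfl
  · exact hzT (mem_insert_of_mem _ (Finset.mem_coe.2 hs))
  · exact hzT (mem_insert _ _)

/-- On `starOpen S v` (with `x ∈ S ∌ v`): `x ↔ u` iff the cluster of `u` meets `S ∪ {v}`. [folklore] -/
theorem starOpen_inter_openConn {S : Finset V} {x v : V} (hx : x ∈ S) (hv : v ∉ S) (u : V) :
    starOpen S v ∩ openConn x u = starOpen S v ∩ hits u (insert v (↑S : Set V)) := by
  have hxv : x ≠ v := fun h => hv (h ▸ hx)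
  ext ω
  simp only [mem_inter_iff, openConn, mem_setOf_eq, hits, mem_insert_iff, Finset.mem_coe]
  refine ⟨fun ⟨hω, hr⟩ => ⟨hω, x, Or.inr hx, hr.symm⟩, fun ⟨hω, t, ht, hr⟩ => ⟨hω, ?_⟩⟩
  have hxadj : (openGraph ω).Adj x v := (openGraph_adj ω x v).2 ⟨hω x hx, hxv⟩
  rcases ht with rfl | ht
  · exact hxadj.reachable.trans hr.symm
  · have htv : t ≠ v := fun h => hv (h ▸ ht)
    have htadj : (openGraph ω).Adj t v := (openGraph_adj ω t v).2 ⟨hω t ht, htv⟩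
    exact (hxadj.reachable.trans htadj.reachable.symm).trans hr.symm

/-! ### Identity (a) at level `0`: the conditioned covariance of `f_S` with an empty avoided set -/

/-- With `Y = ∅` the conditioning event `{x ↮ ∅}` is everything. [folklore] -/
theorem avoid_empty_eq_univ (x : V) :
    {ω : BondConfig V | ∀ y ∈ (∅ : Set V), ¬ (openGraph ω).Reachable x y} = univ :=
  eq_univ_of_forall fun _ _ h => h.elim

/-- **(a), level `0`**: `covD w x ∅ f_S u = W · ( μ{u ~ S ∪ {v}} − μ{u ~ {x}} )`. [folklore] -/
theorem covD_empty_allOpenTo [Fintype V] (w : Sym2 V → unitInterval) {S : Finset V} {x v : V} (hx : x ∈ S) (hv : v ∉ S)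
    (u : V) :
    covD w x ∅ (allOpenTo S v) u =
      starWeight w S v * ((prodBernoulli w).real (hits u (insert v (↑S : Set V))) - (prodBernoulli w).real (hits u {x})) := by
  have hf : (fun ω : BondConfig V => allOpenTo S v (openEdgeCluster ω x)) = (starOpen S v).indicator 1 :=
    funext (allOpenTo_openEdgeCluster hx hv)
  simp only [covD, avoid_empty_eq_univ, univ_inter, Measure.restrict_univ, probReal_univ, one_mul]
  rw [show (fun ω : BondConfig V => allOpenTo S v (openEdgeCluster ω x)) = (starOpen S v).indicator 1 from hf,
    integral_indicator_one MeasurableSet.of_discrete, integral_indicator_one MeasurableSet.of_discrete,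
    measureReal_restrict_apply MeasurableSet.of_discrete, starOpen_inter_openConn hx hv, real_starOpen_inter_hits,
    real_starOpen, hits_singleton]
  ring


/-! ### Identity (a) at every level: induction along the decoys -/

/-- `avoidConst · μ{d ↮ A} = μ{d ↮ A, d ↔ u}` — also when `μ{d ↮ A} = 0` (then both sides vanish; Lean's `x / 0 = 0`). [folklore] -/
theorem avoidConst_mul_real [Fintype V] (w : Sym2 V → unitInterval) (d : V) (A : Set V) (u : V) :
    avoidConst w d A u * (prodBernoulli w).real {ω : BondConfig V | ∀ a ∈ A, ¬ (openGraph ω).Reachable d a} =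
      (prodBernoulli w).real ({ω : BondConfig V | ∀ a ∈ A, ¬ (openGraph ω).Reachable d a} ∩ openConn d u) := by
  unfold avoidConst
  by_cases h0 : (prodBernoulli w).real {ω : BondConfig V | ∀ a ∈ A, ¬ (openGraph ω).Reachable d a} = 0
  · have hle : (prodBernoulli w).real ({ω : BondConfig V | ∀ a ∈ A, ¬ (openGraph ω).Reachable d a} ∩ openConn d u) ≤ 0 :=
      h0 ▸ measureReal_mono inter_subset_left
    rw [h0, mul_zero, le_antisymm hle measureReal_nonneg]
  · exact div_mul_cancel₀ _ h0

/-- `obsConst · μ{v ↮ A} = μ{v ↮ A, o ↔ v}` — also when `μ{v ↮ A} = 0`. [folklore] -/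
theorem obsConst_mul_real [Fintype V] (w : Sym2 V → unitInterval) (o v : V) (A : Set V) :
    obsConst w o v A * (prodBernoulli w).real {ω : BondConfig V | ∀ a ∈ A, ¬ (openGraph ω).Reachable v a} =
      (prodBernoulli w).real ({ω : BondConfig V | ∀ a ∈ A, ¬ (openGraph ω).Reachable v a} ∩ openConn o v) := by
  unfold obsConst
  by_cases h0 : (prodBernoulli w).real {ω : BondConfig V | ∀ a ∈ A, ¬ (openGraph ω).Reachable v a} = 0
  · have hle : (prodBernoulli w).real ({ω : BondConfig V | ∀ a ∈ A, ¬ (openGraph ω).Reachable v a} ∩ openConn o v) ≤ 0 :=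
      h0 ▸ measureReal_mono inter_subset_left
    rw [h0, mul_zero, le_antisymm hle measureReal_nonneg]
  · exact div_mul_cancel₀ _ h0

/-- **Induction along the decoys.** If `g(u) = W·(μ{u ~ T} − μ{u ~ A})` for every `u` and all decoys lie in `T`, then
`sl_{decoyList A D}[g](u) = W·(μ{u ~ T} − μ{u ~ A ∪ D})` for every `u`: one level step replaces `A` by `A ∪ {d}` through
`c_d(u)·W·μ{d ↮ A} = W·μ{d ↮ A, d ↔ u}` and `hits_insert_eq`. [folklore] -/
theorem slForm_decoyList_of_hits [Fintype V] (w : Sym2 V → unitInterval) (T : Set V) (W : ℝ) :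
    ∀ (D : List V) (A : Set V) (g : V → ℝ), (∀ d ∈ D, d ∈ T) →
      (∀ u, g u = W * ((prodBernoulli w).real (hits u T) - (prodBernoulli w).real (hits u A))) →
      ∀ u, slForm (decoyList w A D) g u =
        W * ((prodBernoulli w).real (hits u T) - (prodBernoulli w).real (hits u (A ∪ {d | d ∈ D}))) := by
  intro D
  induction D with
  | nil =>
    intro A g _ hg u
    simp only [decoyList, slForm_nil, List.not_mem_nil, setOf_false, union_empty]
    exact hg u
  | cons d ds ih =>
    intro A g hT hg u
    have hdT : d ∈ T := hT d (by simp)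
    have hset : A ∪ {d' | d' ∈ d :: ds} = insert d A ∪ {d' | d' ∈ ds} := by
      ext z; simp only [List.mem_cons, mem_union, mem_setOf_eq, mem_insert_iff]; tauto
    rw [decoyList, slForm_cons_eq, hset]
    refine ih (insert d A) _ (fun d' hd' => hT d' (by simp [hd'])) (fun u' => ?_) u
    simp only [slStep]
    rw [hg u', hg d, hits_eq_univ_of_mem hdT, probReal_univ, ← real_avoid_eq_one_sub, real_hits_insert,
      ← avoidConst_mul_real]
    ring

end SharpWitness

end CSH

end Summit.CriticalPhenomena.PercolationContinuityZ3.Theorems
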